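import Mathlib.LinearAlgebra.Matrix.Charpoly.LinearMap
import Literature.NumberTheory.GaloisRepresentations.GaloisRep
import Literature.NumberTheory.GaloisRepresentations.HeckeCharacter
import Literature.NumberTheory.LFunctions.NumberFieldDirichletDensity
import HarnessLib

/-!
# Weak abelian direct summands of `ℓ`-adic representations (Böckle–Hui 2025, Thm. 1.1)

Topic `NumberTheory/GaloisRepresentations`; namespace `Literature.NumberTheory.GaloisRepresentations`
(definitions in the `FramedGaloisRep` namespace for dot notation).

Source: G. Böckle, C.-Y. Hui, *Weak abelian direct summands and irreducibility of Galois
representations*, Math. Ann. 393 (2025) 543–569, `doi:10.1007/s00208-025-03252-0` =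
`arXiv:2404.08954` [BockleHui2025].  Quotations below are from the held arXiv text
(`paper:arxiv-2404.08954`, pp. 3, 5, 6, 13).

> **§2.1.** "Let `E ⊂ ℚ̄_ℓ` be a number field. An `n`-dimensional `ℓ`-adic representation
> `ρ_ℓ : Gal_K → GL_n(ℚ̄_ℓ)` is said to be *`E`-rational* if there is a finite subset `S ⊂ Σ_K`
> such that for every finite place `v ∈ Σ_K \ S`, the representation `ρ_ℓ` is unramified at `v` and
> the characteristic polynomial of `ρ_ℓ(Frob_v)` has coefficients in `E`."
> **§1.1.** "Let `ψ_ℓ` be an abelian semisimple `ℓ`-adic representation of `K`. We say that `ψ_ℓ` is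
> a *weak abelian direct summand* of `ρ_ℓ` if there is a subset `𝓛 ⊂ Σ_K` of Dirichlet density one
> such that for all `v ∈ 𝓛`, `ψ_ℓ` and `ρ_ℓ` are unramified at `v` and the characteristic polynomial
> of `ψ_ℓ(Frob_v)` divides those of `ρ_ℓ(Frob_v)`."  (Definition 2.3 of §2.6.1 restates this as
> "`ψ` weakly divides `ρ`": the set `S_{ψ∣ρ}` of such `v` "is of Dirichlet density one".)
> **Theorem 1.1.** "Let `K` and `E ⊂ ℚ̄_ℓ` be number fields, and `ρ_ℓ : Gal_K → GL_n(ℚ̄_ℓ)` a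
> semisimple `E`-rational `ℓ`-adic representation of `K`. If `ψ_ℓ` is a weak abelian direct
> summand of `ρ_ℓ`, then it is locally algebraic, and thus its local representations at places
> above `ℓ` are de Rham."
> **§3.2.1** (proof of Thm. 1.2, `τ_λ` a character that is a direct summand of `ρ_λ`): "Since `τ_λ`
> is locally algebraic by Theorem 1.1, it comes from an algebraic Hecke character `τ` of `K`."
> **Remark 2.1.** "Local algebraicity of `φ_ℓ` depends solely on the local representations
> `φ_ℓ|_{Gal_{K_v}}` for all `v ∈ S_ℓ`. By [Se98], `φ_ℓ` is locally algebraic if and only if these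
> local representations are Hodge–Tate."

## Contents

* `FramedGaloisRep.IsRationalOver e ρ` — `ρ : Γ_K →ₜ* GL_n(A)` is **`E`-rational** with respect to
  a ring map `e : E →+* A` (BH §2.1 with `A = ℚ̄_ℓ = PadicAlgCl ℓ` and `e` the inclusion of the
  number field `E ⊂ ℚ̄_ℓ`): at all but finitely many finite places `v`, `ρ` is unramified and its
  (arithmetic) Frobenius characteristic polynomial (`FramedGaloisRep.HasFrobCharpolyAt`) is the
  image of a polynomial over `E`.  A real definition.
* `FramedGaloisRep.WeaklyDivides ψ ρ` — `ψ` is a **weak direct summand** of `ρ` (BH §1.1 /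
  Def. 2.3): there is a set `𝓛` of finite places of Dirichlet density one (Neukirch's notion, the
  tree's `Literature.NumberTheory.LFunctions.NumberField.HasDirichletDensity K 𝓛 1`) at every
  `v` of which both are unramified and `charpoly ψ(σ) ∣ charpoly ρ(σ)` for every arithmetic
  Frobenius `σ` at every prime above `v`.  A real definition; API: `weaklyDivides_iff`,
  `hasDirichletDensity_one_of_eventually` (cofinite sets have density one),
  `WeaklyDivides.of_eventually`, and `weaklyDivides_of_stableLine` (a character occurring on a
  stable line of an almost everywhere unramified `ρ` weakly divides `ρ`; BH §1.1: "Abelian direct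
  summands (i.e., subrepresentations) of `ρ_ℓ` are obvious examples of weak abelian direct
  summands").
* `exists_heckeCharacter_of_weaklyDivides` — **Böckle–Hui, Theorem 1.1** for characters, as the
  NAMED FACT (D-0014) in the form printed in BH §3.2.1: a character `ψ : Γ_K → GL_1(ℚ̄_ℓ)` weakly
  dividing a semisimple `E`-rational `ρ : Γ_K → GL_n(ℚ̄_ℓ)` *comes from an algebraic Hecke
  character*: for every field isomorphism `ι : ℚ̄_ℓ ≃+* ℂ` there is an algebraic (type `A₀`)
  Hecke character `χ` of `K` (`HeckeCharacter.IsAlgebraic`) with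
  `ψ(Frob_v^{arith}) = ι⁻¹(χ(ϖ_v))⁻¹` at all but finitely many `v`.
* `exists_heckeCharacter_of_stableLine` — the proved corollary used by consumers
  (`Summits/Langlands/…/Theses/ReducibleSelfDual`): the same conclusion for a character `τ` occurring
  on a `ρ`-stable line.

## Faithfulness notes (read before using the fact)

* **"Locally algebraic" is rendered by its Hecke-character avatar.**  BH §2.3 define local
  algebraicity through the Artin reciprocity map `i_ℓ : (K ⊗ ℚ_ℓ)ˣ → 𝔸_Kˣ/Kˣ → Gal_K^ab`
  (`φ_ℓ ∘ i_ℓ(x) = r_ℓ(x⁻¹)` near `1` for an algebraic `r_ℓ : T_K × ℚ̄_ℓ → GL_n`).  The tree has no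
  *canonical* global or local reciprocity map: `exists_isGlobalReciprocityMap` /
  `exists_isLocalReciprocityMap` are existential, and their predicates do not pin the map down (a
  `ℤ_ℓˣ`-power automorphism of the pro-`ℓ` part of `Gal_K^ab` preserves them and destroys local
  algebraicity), so a reciprocity-map-quantified `IsLocallyAlgebraic` would be unfaithful.  For a
  character `ψ`, local algebraicity is EQUIVALENT (Serre, *Abelian ℓ-adic representations*, Ch. III
  §2.3 Thm. 2 with Ch. II §2.7, in the `ℚ̄_ℓ`-coefficient form of BH §2.4 "(Loc-alg) ⇔ (E-SCS) ⇔
  (E-rat)"; Weil 1956 for the converse construction; Chebotarev for uniqueness) to: for every (equivalently one) field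
  isomorphism `ι : ℚ̄_ℓ ≃ ℂ` there is an algebraic Hecke character `χ` with
  `ι(ψ(Frob_v)) = χ(ϖ_v)^{±1}` for almost all `v` — and this is the form in which BH themselves use
  Theorem 1.1 (§3.2.1, quoted above) and in which the consumers need it.  The sign is immaterial
  (`χ ↦ χ⁻¹` preserves algebraicity); we take `ψ(Frob_v^{arith}) = ι⁻¹(χ(ϖ_v))⁻¹`, i.e.
  `ψ.HasFrobCharpolyAt v (X - C (ι.symm (χ.valueAtUniformizer v)⁻¹))`, which is literally
  `Literature.NumberTheory.Automorphic.arithFrobPolyOfSatake ι q_v 1 {χ(ϖ_v)}`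
  (`arithFrobPolyOfSatake_one`).
* **Characters instead of abelian semisimple `ψ` of rank `m`.**  Over the algebraically closed
  field `ℚ̄_ℓ` an abelian semisimple `ψ` is a direct sum of characters `χ_i`; if `ψ` weakly divides
  `ρ` so does every `χ_i` (same density-one set: `X - χ_i(Frob_v)` divides `charpoly ψ(Frob_v)`),
  and `ψ` is locally algebraic iff every `χ_i` is.  So the rank-one statement carries the content of
  Theorem 1.1; only the bookkeeping of the decomposition is not restated.
* **The clause "and thus … de Rham" is not restated**: the tree's `p`-adic Hodge predicates
  (`PAdicHodge.lean`) are relative to a supplied period-ring datum, and the clause is a consequence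
  ("thus", Remark 2.1) of local algebraicity, not an independent assertion.
* `E ⊂ ℚ̄_ℓ` is an abstract number field `E` with a ring map `e : E →+* PadicAlgCl ℓ`.
  "Characteristic polynomial of `Frob_v`": the tree's `HasFrobCharpolyAt` uses `det(X - ρ(σ))` for
  *arithmetic* Frobenii `σ`; BH write `det(ρ(Frob_v) - T)` and do not fix arithmetic/geometric —
  having coefficients in `E`, and divisibility, are insensitive to both choices (`±` sign; for the
  inverse matrix the reversed polynomial scaled by the unit `det⁻¹ ∈ E`).
* Theorem 1.1 (with the §1.1 definition) does not assume `ψ` unramified almost everywhere (for a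
  continuous `ℓ`-adic character this is automatic); neither do we.

## Mathlib / tree search

Mathlib (pin v4.32.0) has no Galois-representation rationality, compatible-system, weak-divisibility
or local-algebraicity notions (`rg -i "locally algebraic|E-rational|weak.*summand|Hecke character"`
over `Mathlib/NumberTheory`, `Mathlib/RepresentationTheory`: nothing).  Tree notions reused:
`FramedGaloisRep`, `IsUnramifiedAt`, `HasFrobCharpolyAt`, `FramedRep.charpoly`, `toGaloisRep`,
`ContinuousRep.IsSemisimple` (`GaloisRep.lean`, `ContinuousRep.lean`); `HeckeCharacter`,
`IsAlgebraic`, `IsUnramifiedAt`, `valueAtUniformizer` (`HeckeCharacter.lean`);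
`LFunctions.NumberField.HasDirichletDensity`, `hasDirichletDensity_univ`,
`HasStrongDirichletDensity.of_finite_symmDiff` (`LFunctions/`).  Mathlib anchors: `PadicAlgCl`,
`IsArithFrobAt`, `Matrix.charpoly`, `Matrix.eval_charpoly`, `Matrix.exists_mulVec_eq_zero_iff`,
`Polynomial.dvd_iff_isRoot`, `Matrix.det_fin_one`.

## References

* G. Böckle, C.-Y. Hui, Math. Ann. 393 (2025), Thm. 1.1, §1.1, §2.1, §2.3–2.4, Def. 2.3, Rem. 2.1,
  §3.2.1. [BockleHui2025]
* J.-P. Serre, *Abelian ℓ-adic representations and elliptic curves* (1968), Ch. II §2.7, Ch. III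
  §§1.1, 2.3, 3 (locally algebraic representations and Hecke characters). [SerreAbelianLadic1968]
* J. Neukirch, *Algebraic Number Theory* (1999), VII (13.1) (Dirichlet density). [NeukirchANT1999]
-/

noncomputable section

open scoped NumberField Matrix
open Field IsDedekindDomain Polynomial Filter

namespace Literature.NumberTheory.GaloisRepresentations

universe u v

/-! ### Cofinite sets of places have Dirichlet density one -/

section Density

variable {K : Type u} [Field K] [NumberField K]

/-- **A cofinite set of places has Dirichlet density one**: if `p v` holds for all but finitely
many finite places `v` of the number field `K`, then `{v | p v}` has Dirichlet density `1` in
Neukirch's sense (the set of all primes has strong density `1`, `hasStrongDirichletDensity_univ`;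
finitely many exceptions do not change it, `HasStrongDirichletDensity.of_finite_symmDiff`; strong
density implies Neukirch's density, `HasStrongDirichletDensity.numberField_hasDirichletDensity`).
Ref: Neukirch, *Algebraic Number Theory*, VII (13.1)–(13.2). [folklore] -/
theorem hasDirichletDensity_one_of_eventually {p : HeightOneSpectrum (𝓞 K) → Prop}
    (h : ∀ᶠ v : HeightOneSpectrum (𝓞 K) in cofinite, p v) :
    LFunctions.NumberField.HasDirichletDensity K {v | p v} 1 := by
  have hfin : {v : HeightOneSpectrum (𝓞 K) | ¬ p v}.Finite := Filter.eventually_cofinite.mp h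
  have hs : LFunctions.HasStrongDirichletDensity K {v | p v} 1 :=
    (LFunctions.hasStrongDirichletDensity_univ K).of_finite_symmDiff hfin fun q hq => by
      simp only [Set.mem_setOf_eq, not_not] at hq
      exact ⟨fun _ => hq, fun _ => Set.mem_univ q⟩
  exact hs.numberField_hasDirichletDensity

end Density

namespace FramedGaloisRep

/-! ### `E`-rationality (BH §2.1) -/

section Rational

variable {K : Type u} [Field K] {A : Type v} [CommRing A] [TopologicalSpace A]
  {E : Type*} [CommRing E] {n : ℕ}

/-- `ρ : Γ_K →ₜ* GL_n(A)` is **`E`-rational** with respect to the ring map `e : E →+* A` (for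
`A = ℚ̄_ℓ` and `e` the inclusion of a number field `E ⊂ ℚ̄_ℓ` this is Serre's / Böckle–Hui's
notion): for all but finitely many finite places `v` of `K`, `ρ` is unramified at `v` and the
characteristic polynomial of (arithmetic) Frobenius at `v` is `P.map e` for some `P ∈ E[X]`
("there is a finite subset `S ⊂ Σ_K` such that for every finite place `v ∈ Σ_K \ S`, the
representation `ρ_ℓ` is unramified at `v` and the characteristic polynomial of `ρ_ℓ(Frob_v)` has
coefficients in `E`").  [cite: BockleHui2025, §2.1] -/
def IsRationalOver (e : E →+* A) (ρ : FramedGaloisRep K A n) : Prop :=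
  ∀ᶠ v : HeightOneSpectrum (𝓞 K) in cofinite,
    ρ.IsUnramifiedAt v ∧ ∃ P : Polynomial E, ρ.HasFrobCharpolyAt v (P.map e)

/-- Unfolding lemma for `IsRationalOver`. [folklore] -/
theorem isRationalOver_iff {e : E →+* A} {ρ : FramedGaloisRep K A n} :
    ρ.IsRationalOver e ↔ ∀ᶠ v : HeightOneSpectrum (𝓞 K) in cofinite,
      ρ.IsUnramifiedAt v ∧ ∃ P : Polynomial E, ρ.HasFrobCharpolyAt v (P.map e) :=
  Iff.rfl

/-- An `E`-rational representation is unramified at all but finitely many places. [folklore] -/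
theorem IsRationalOver.eventually_isUnramifiedAt {e : E →+* A} {ρ : FramedGaloisRep K A n}
    (h : ρ.IsRationalOver e) : ∀ᶠ v : HeightOneSpectrum (𝓞 K) in cofinite, ρ.IsUnramifiedAt v :=
  h.mono fun _ hv => hv.1

end Rational

/-! ### Weak direct summands (BH §1.1, Def. 2.3) -/

section Weak

variable {K : Type u} [Field K] [NumberField K] {A : Type v} [CommRing A] [TopologicalSpace A]
  {n m : ℕ}

/-- `ψ.WeaklyDivides ρ`: the representation `ψ : Γ_K →ₜ* GL_m(A)` is a **weak direct summand** of
`ρ : Γ_K →ₜ* GL_n(A)` ("`ψ` weakly divides `ρ`"): there is a set `𝓛` of finite places of `K` of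
Dirichlet density one (Neukirch VII (13.1), `LFunctions.NumberField.HasDirichletDensity K 𝓛 1`)
such that for every `v ∈ 𝓛`, both `ρ` and `ψ` are unramified at `v` and the characteristic
polynomial of `ψ` at every arithmetic Frobenius `σ` at every prime `𝔓 ∣ v` divides that of `ρ`
("there is a subset `𝓛 ⊂ Σ_K` of Dirichlet density one such that for all `v ∈ 𝓛`, `ψ_ℓ` and `ρ_ℓ`
are unramified at `v` and the characteristic polynomial of `ψ_ℓ(Frob_v)` divides those of
`ρ_ℓ(Frob_v)`"; for unramified `v` the condition does not depend on the Frobenius chosen).  When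
`ψ` is abelian it is then called a *weak abelian direct summand* of `ρ`.
[cite: BockleHui2025, §1.1 and Definition 2.3] -/
def WeaklyDivides (ψ : FramedGaloisRep K A m) (ρ : FramedGaloisRep K A n) : Prop :=
  ∃ 𝓛 : Set (HeightOneSpectrum (𝓞 K)), LFunctions.NumberField.HasDirichletDensity K 𝓛 1 ∧
    ∀ v ∈ 𝓛, ρ.IsUnramifiedAt v ∧ ψ.IsUnramifiedAt v ∧
      ∀ 𝔓 ∈ v.primesAbove, ∀ σ : absoluteGaloisGroup K, IsArithFrobAt (𝓞 K) σ 𝔓 →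
        FramedRep.charpoly ψ σ ∣ FramedRep.charpoly ρ σ

/-- Unfolding lemma for `WeaklyDivides`. [folklore] -/
theorem weaklyDivides_iff {ψ : FramedGaloisRep K A m} {ρ : FramedGaloisRep K A n} :
    ψ.WeaklyDivides ρ ↔
      ∃ 𝓛 : Set (HeightOneSpectrum (𝓞 K)), LFunctions.NumberField.HasDirichletDensity K 𝓛 1 ∧
        ∀ v ∈ 𝓛, ρ.IsUnramifiedAt v ∧ ψ.IsUnramifiedAt v ∧
          ∀ 𝔓 ∈ v.primesAbove, ∀ σ : absoluteGaloisGroup K, IsArithFrobAt (𝓞 K) σ 𝔓 →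
            FramedRep.charpoly ψ σ ∣ FramedRep.charpoly ρ σ :=
  Iff.rfl

/-- A representation `ψ` which, at all but finitely many places, is unramified together with `ρ`
and has Frobenius characteristic polynomials dividing those of `ρ`, weakly divides `ρ` (cofinite
sets have Dirichlet density one).  This covers genuine direct summands ("Abelian direct summands
(i.e., subrepresentations) of `ρ_ℓ` are obvious examples of weak abelian direct summands").
[cite: BockleHui2025, §1.1] -/
theorem WeaklyDivides.of_eventually {ψ : FramedGaloisRep K A m} {ρ : FramedGaloisRep K A n}
    (h : ∀ᶠ v : HeightOneSpectrum (𝓞 K) in cofinite, ρ.IsUnramifiedAt v ∧ ψ.IsUnramifiedAt v ∧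
      ∀ 𝔓 ∈ v.primesAbove, ∀ σ : absoluteGaloisGroup K, IsArithFrobAt (𝓞 K) σ 𝔓 →
        FramedRep.charpoly ψ σ ∣ FramedRep.charpoly ρ σ) :
    ψ.WeaklyDivides ρ :=
  ⟨_, hasDirichletDensity_one_of_eventually h, fun _ hv => hv⟩

end Weak

/-! ### Characters on stable lines weakly divide -/

section StableLine

variable {K : Type u} [Field K] [NumberField K] {A : Type v} [CommRing A] [IsDomain A]
  [TopologicalSpace A] [IsTopologicalRing A] {n : ℕ}

omit [NumberField K] [IsDomain A] [TopologicalSpace A] [IsTopologicalRing A] in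
/-- The characteristic polynomial of a rank-one framed representation at `g` is
`X - det (τ g)` (a `1 × 1` matrix). [folklore] -/
theorem charpoly_eq_X_sub_C_det [TopologicalSpace A] (τ : FramedGaloisRep K A 1)
    (g : absoluteGaloisGroup K) :
    FramedRep.charpoly τ g = X - C ((Matrix.GeneralLinearGroup.det (τ g) : Aˣ) : A) := by
  rw [FramedRep.charpoly, Matrix.charpoly, Matrix.det_fin_one, Matrix.GeneralLinearGroup.val_det_apply,
    Matrix.det_fin_one]
  simp

/-- **A character occurring on a stable line weakly divides.**  Let `ρ : Γ_K →ₜ* GL_n(A)` (`A` a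
domain) be unramified at all but finitely many places and let the character `τ : Γ_K →ₜ* GL_1(A)`
occur on a `ρ`-stable line: `ρ(g) x = det(τ(g)) • x` for all `g`, for some `x ≠ 0`.  Then `τ`
weakly divides `ρ`: wherever `ρ` is unramified so is `τ` (`(det τ(σ) - 1) • x = 0` forces
`τ(σ) = 1`), and `X - det τ(σ)` divides `charpoly ρ(σ)` for every `σ` (an eigenvalue is a root of
the characteristic polynomial, `Matrix.eval_charpoly`, `Matrix.exists_mulVec_eq_zero_iff`); a
cofinite set of places has Dirichlet density one.  BH §1.1: "Abelian direct summands (i.e.,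
subrepresentations) of `ρ_ℓ` are obvious examples of weak abelian direct summands".
[cite: BockleHui2025, §1.1] -/
theorem weaklyDivides_of_stableLine {ρ : FramedGaloisRep K A n} {τ : FramedGaloisRep K A 1}
    (hρ : ∀ᶠ v : HeightOneSpectrum (𝓞 K) in cofinite, ρ.IsUnramifiedAt v)
    (hx : ∃ x : Fin n → A, x ≠ 0 ∧ ∀ g : absoluteGaloisGroup K,
      ρ.toGaloisRep g x = ((Matrix.GeneralLinearGroup.det (τ g) : Aˣ) : A) • x) :
    τ.WeaklyDivides ρ := by
  obtain ⟨x, hx0, hx⟩ := hx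
  -- matrix form of the eigenvector equation
  have hmul : ∀ g : absoluteGaloisGroup K,
      ((ρ g : GL (Fin n) A) : Matrix (Fin n) (Fin n) A) *ᵥ x =
        ((Matrix.GeneralLinearGroup.det (τ g) : Aˣ) : A) • x := fun g => by
    simpa using hx g
  -- `τ` is unramified wherever `ρ` is
  have hunr : ∀ v, ρ.IsUnramifiedAt v → τ.IsUnramifiedAt v := by
    intro v hv 𝔓 h𝔓 σ hσ
    have h1 : ρ σ = 1 := hv 𝔓 h𝔓 σ hσ
    have h2 := hmul σ
    rw [h1] at h2
    simp only [Units.val_one, Matrix.one_mulVec] at h2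
    -- `x = d • x` with `x ≠ 0` forces `d = 1`
    obtain ⟨i, hi⟩ : ∃ i, x i ≠ 0 := by
      simpa using Function.ne_iff.mp hx0
    have h3 : ((Matrix.GeneralLinearGroup.det (τ σ) : Aˣ) : A) * x i = x i := by
      simpa using (congrFun h2 i).symm
    have hd : ((Matrix.GeneralLinearGroup.det (τ σ) : Aˣ) : A) = 1 := by
      have : (((Matrix.GeneralLinearGroup.det (τ σ) : Aˣ) : A) - 1) * x i = 0 := by
        rw [sub_mul, one_mul, h3, sub_self]
      rcases mul_eq_zero.mp this with h | h
      · exact sub_eq_zero.mp h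
      · exact absurd h hi
    -- a `1 × 1` invertible matrix with determinant `1` is `1`
    refine Units.ext (Matrix.ext fun i j => ?_)
    have hdet : ((τ σ : GL (Fin 1) A) : Matrix (Fin 1) (Fin 1) A).det = 1 := by
      rw [← Matrix.GeneralLinearGroup.val_det_apply, hd]
    rw [Matrix.det_fin_one] at hdet
    rw [Subsingleton.elim i 0, Subsingleton.elim j 0, hdet]
    simp
  -- divisibility of characteristic polynomials at every `σ`
  have hdvd : ∀ σ : absoluteGaloisGroup K, FramedRep.charpoly τ σ ∣ FramedRep.charpoly ρ σ := by
    intro σ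
    rw [charpoly_eq_X_sub_C_det, dvd_iff_isRoot, IsRoot.def, FramedRep.charpoly, Matrix.eval_charpoly,
      ← Matrix.exists_mulVec_eq_zero_iff]
    refine ⟨x, hx0, ?_⟩
    rw [Matrix.sub_mulVec, hmul σ]
    ext i
    simp [Matrix.scalar_apply]
  refine WeaklyDivides.of_eventually (hρ.mono fun v hv => ⟨hv, hunr v hv, ?_⟩)
  intro 𝔓 _ σ _
  exact hdvd σ

end StableLine

end FramedGaloisRep

/-! ### Böckle–Hui, Theorem 1.1 (named fact) and its stable-line corollary -/

/-- **Böckle–Hui 2025, Theorem 1.1 (weak abelian direct summands of `E`-rational semisimple `ℓ`-adic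
representations are locally algebraic), for characters, in the Hecke-character form of BH §3.2.1.**
Let `K` be a number field, `ℓ` a prime, `E` a number field with an embedding `e : E →+* ℚ̄_ℓ`
(`ℚ̄_ℓ = PadicAlgCl ℓ`), `ρ : Γ_K →ₜ* GL_n(ℚ̄_ℓ)` a continuous representation which is semisimple
(`ρ.toGaloisRep.IsSemisimple`) and `E`-rational (`ρ.IsRationalOver e`), and `ψ : Γ_K →ₜ* GL_1(ℚ̄_ℓ)`
a character which is a weak (abelian) direct summand of `ρ` (`ψ.WeaklyDivides ρ`).  Then `ψ` is
locally algebraic — stated here through its equivalent (Serre 1968, Ch. III §2.3 with Ch. II §2.7;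
BH §2.4; see the module docstring) and as printed in BH §3.2.1 ("Since `τ_λ` is locally algebraic by
Theorem 1.1, it comes from an algebraic Hecke character `τ` of `K`"): for every field isomorphism
`ι : ℚ̄_ℓ ≃+* ℂ` there is an **algebraic** (type `A₀`, `HeckeCharacter.IsAlgebraic`) Hecke character
`χ` of `K` such that at all but finitely many finite places `v`, `χ` and `ψ` are unramified and the
arithmetic Frobenius satisfies `ψ(Frob_v) = ι⁻¹(χ(ϖ_v))⁻¹`, i.e.
`ψ.HasFrobCharpolyAt v (X - C (ι⁻¹(χ(ϖ_v))⁻¹))` (`= arithFrobPolyOfSatake ι q_v 1 {χ(ϖ_v)}`).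
Printed statement: "Let `K` and `E ⊂ ℚ̄_ℓ` be number fields, and `ρ_ℓ : Gal_K → GL_n(ℚ̄_ℓ)` a
semisimple `E`-rational `ℓ`-adic representation of `K`. If `ψ_ℓ` is a weak abelian direct summand of
`ρ_ℓ`, then it is locally algebraic, and thus its local representations at places above `ℓ` are de
Rham."  (The de Rham clause and the rank-`m` abelian case are discussed in the module docstring.)
Named fact (D-0014). [cite: BockleHui2025, Theorem 1.1 and §3.2.1] -/
def exists_heckeCharacter_of_weaklyDivides : Prop :=
  ∀ (K : Type) [Field K] [NumberField K] (ℓ : ℕ) [Fact ℓ.Prime] (n : ℕ)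
    (E : Type) [Field E] [NumberField E] (e : E →+* PadicAlgCl ℓ)
    (ρ : FramedGaloisRep K (PadicAlgCl ℓ) n), ρ.toGaloisRep.IsSemisimple → ρ.IsRationalOver e →
    ∀ (ψ : FramedGaloisRep K (PadicAlgCl ℓ) 1), ψ.WeaklyDivides ρ →
    ∀ (ι : PadicAlgCl ℓ ≃+* ℂ), ∃ χ : HeckeCharacter K, χ.IsAlgebraic ∧
      ∀ᶠ v : HeightOneSpectrum (𝓞 K) in cofinite, χ.IsUnramifiedAt v ∧ ψ.IsUnramifiedAt v ∧
        ψ.HasFrobCharpolyAt v (X - C (ι.symm (χ.valueAtUniformizer v)⁻¹))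

/-- Unfolding lemma for `exists_heckeCharacter_of_weaklyDivides`. [folklore] -/
theorem exists_heckeCharacter_of_weaklyDivides_iff :
    exists_heckeCharacter_of_weaklyDivides ↔
      ∀ (K : Type) [Field K] [NumberField K] (ℓ : ℕ) [Fact ℓ.Prime] (n : ℕ)
        (E : Type) [Field E] [NumberField E] (e : E →+* PadicAlgCl ℓ)
        (ρ : FramedGaloisRep K (PadicAlgCl ℓ) n), ρ.toGaloisRep.IsSemisimple → ρ.IsRationalOver e →
        ∀ (ψ : FramedGaloisRep K (PadicAlgCl ℓ) 1), ψ.WeaklyDivides ρ →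
        ∀ (ι : PadicAlgCl ℓ ≃+* ℂ), ∃ χ : HeckeCharacter K, χ.IsAlgebraic ∧
          ∀ᶠ v : HeightOneSpectrum (𝓞 K) in cofinite, χ.IsUnramifiedAt v ∧ ψ.IsUnramifiedAt v ∧
            ψ.HasFrobCharpolyAt v (X - C (ι.symm (χ.valueAtUniformizer v)⁻¹)) :=
  Iff.rfl

/-- **Corollary (characters on stable lines of `E`-rational semisimple representations are
Hecke).**  Granting Böckle–Hui's Theorem 1.1 (`exists_heckeCharacter_of_weaklyDivides`): if
`ρ : Γ_K →ₜ* GL_n(ℚ̄_ℓ)` is semisimple and `E`-rational and the character `τ : Γ_K →ₜ* GL_1(ℚ̄_ℓ)`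
occurs on a `ρ`-stable line (`ρ(g) x = det(τ g) • x` for some `x ≠ 0`), then for every
`ι : ℚ̄_ℓ ≃+* ℂ` there is an algebraic Hecke character `χ` of `K` with `χ`, `τ` unramified and
`τ(Frob_v) = ι⁻¹(χ(ϖ_v))⁻¹` at all but finitely many `v` (`τ` weakly divides `ρ` by
`FramedGaloisRep.weaklyDivides_of_stableLine`).  This is the shape consumed by
`Summit.Langlands.Langlands.Theses.ReducibleSelfDual.AbelianSummandIsHecke` (with `E`-rationality of
`r_{ℓ,ι}(π)` from Clozel's theorem).  BH §3.2.1: "we have a decomposition `ρ_λ = σ_λ ⊕ τ_λ` where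
… `τ_λ` is a character. … Since `τ_λ` is locally algebraic by Theorem 1.1, it comes from an
algebraic Hecke character `τ` of `K`." [cite: BockleHui2025, §3.2.1] -/
theorem exists_heckeCharacter_of_stableLine (h : exists_heckeCharacter_of_weaklyDivides)
    {K : Type} [Field K] [NumberField K] {ℓ : ℕ} [Fact ℓ.Prime] {n : ℕ}
    {E : Type} [Field E] [NumberField E] (e : E →+* PadicAlgCl ℓ)
    {ρ : FramedGaloisRep K (PadicAlgCl ℓ) n} (hss : ρ.toGaloisRep.IsSemisimple)
    (hrat : ρ.IsRationalOver e) (τ : FramedGaloisRep K (PadicAlgCl ℓ) 1)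
    (hx : ∃ x : Fin n → PadicAlgCl ℓ, x ≠ 0 ∧ ∀ g : absoluteGaloisGroup K,
      ρ.toGaloisRep g x = ((Matrix.GeneralLinearGroup.det (τ g) : (PadicAlgCl ℓ)ˣ) : PadicAlgCl ℓ) • x)
    (ι : PadicAlgCl ℓ ≃+* ℂ) :
    ∃ χ : HeckeCharacter K, χ.IsAlgebraic ∧
      ∀ᶠ v : HeightOneSpectrum (𝓞 K) in cofinite, χ.IsUnramifiedAt v ∧ τ.IsUnramifiedAt v ∧
        τ.HasFrobCharpolyAt v (X - C (ι.symm (χ.valueAtUniformizer v)⁻¹)) :=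
  h K ℓ n E e ρ hss hrat τ
    (FramedGaloisRep.weaklyDivides_of_stableLine hrat.eventually_isUnramifiedAt hx) ι

end Literature.NumberTheory.GaloisRepresentations
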